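import Summits.QuantumFields.YangMills.Theorems.ColdStartUniversalityLatticeLangevinLoopAverageCarre
import Summits.QuantumFields.YangMills.Theorems.ColdStartUniversalityLatticeLangevinPlaquetteVariance
import HarnessLib

/-!
# Route `ColdStartUniversality` (fixed-cut-off package, Bakry–Émery side): VOLUME-UNIFORM VARIANCE AND GAUSSIAN CONCENTRATION OF SPATIALLY
# AVERAGED RECTANGULAR WILSON LOOPS under the SU(2) Wilson measure on `(ℤ/L)³` at `|β'| < 1/12`

Helper file (seat `ym-line-csu-p1`, g27; `--supports stmt-QuantumFields-24809`).  For the `R × T` rectangular Wilson loop `W_γ(V) = ½ Re tr ρ(hol_γ(V))`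
of the tree's S12 vocabulary (`wilsonLoop (fundamentalRep (Fin 2)) x i j R T`, `ConstructiveQFTWave0`) and its SPATIAL AVERAGE
`W̄ = (L³)⁻¹ Σ_x W_(γ+x)` over all base points of the torus:
* `lineHolonomy_eq_listProd`, `fundamentalRep_inv_eq_conjTranspose`, ★ `fundamentalRep_rectangleHolonomy` — the rectangle holonomy read in
  matrices is the word of the rectangle SHAPE (a list of `2(R+T)` letters `(offset, direction, orientation)`) translated to `x`;
* `loopAverage_coords_eq` — the averaged loop functional of `…LoopAverageCarre` with `c = 1/(2L³)` IS `W̄` through the coordinates;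
* ★★ `wilson_loopAverage_variance_uniform` — `Var_(μ_β')(W̄) ≤ 48(R+T)²/((1 − 12|β'|)·L³)` for every `L`, `|β'| < 1/12`, `i, j, R, T`;
* ★★★ `wilson_loopAverage_concentration_uniform` — for `R + T > 0`, `r ≥ 0`:
  `μ_(β'){V | r ≤ |W̄(V) − ∫W̄ dμ_(β')|} ≤ 2·exp(−(1 − 12|β'|)·L³·r²/(96(R+T)²))`.
(Any `i, j, R, T`; for `i = j` or wrapping loops the statement is still true, just less interesting.)  Inputs: `wilson_loopAverage_carre_le`
(`Γ ≤ 32c²|ℓ|²#E = 24(2(R+T))²/L³·…`), `wilson_variance_le_of_carre_uniform`, `wilson_concentration_uniform`.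
[cite: ShenZhuZhu2022, §4 Theorem 4.2, Corollary 4.4]  HONEST FRAMING: FIXED cut-off and fixed `|β'| < 1/12` (uniform in `L` and in the loop's position);
no area law / string tension statement; 24809 ASIDE not restated; no crux, rung or summit statement is proved; the Yang–Mills mass gap is NOT proved.
THEOREMS ONLY, no definition, no sorry.
-/

set_option autoImplicit false

noncomputable section

namespace Summit.QuantumFields.YangMills.Theorems.ColdStartUniversality

open MeasureTheory ProbabilityTheory Matrix Complex Finset
open scoped ComplexConjugate BigOperators Matrix NNReal ENNReal
open Literature.MathematicalPhysics.QuantumFieldTheory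
open Literature.MathematicalPhysics.QuantumLattice (fundamentalRep fundamentalLatticeRep continuous_fundamentalRep fundamentalRep_apply)

variable {L : ℕ} [NeZero L]

/-! ## §1. The rectangle holonomy as a word -/

omit [NeZero L] in
/-- The straight-line holonomy as an ordered list product: `lineHolonomy U k n y = Π_(m<n) U(y + m e_k, k)`. [folklore] -/
theorem lineHolonomy_eq_listProd {G : Type*} [Group G] (U : GaugeConfig 3 L G) (k : Fin 3) :
    ∀ (n : ℕ) (y : Site 3 L), lineHolonomy U k n y = ((List.range n).map fun m : ℕ => U (y + (Pi.single k ((m : ℕ) : ZMod L) : Site 3 L), k)).prod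
  | 0, y => by simp [lineHolonomy]
  | n + 1, y => by
      rw [lineHolonomy, lineHolonomy_eq_listProd U k n (y.shift k), List.range_succ_eq_map, List.map_cons, List.prod_cons, List.map_map]
      congr 1
      · simp
      · refine congrArg List.prod (List.map_congr_left fun m _ => ?_)
        show U (y.shift k + (Pi.single k ((m : ℕ) : ZMod L) : Site 3 L), k) = U (y + (Pi.single k (((m.succ : ℕ)) : ZMod L) : Site 3 L), k)
        congr 2
        rw [Site.shift, add_assoc, ← Pi.single_add]
        congr 2
        push_cast
        ring

/-- For `SU(2)`: `ρ(g⁻¹) = ρ(g)ᴴ`. [folklore] -/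
theorem fundamentalRep_inv_eq_conjTranspose (g : Matrix.specialUnitaryGroup (Fin 2) ℂ) :
    (fundamentalRep (Fin 2) g⁻¹ : Matrix (Fin 2) (Fin 2) ℂ) = (fundamentalRep (Fin 2) g : Matrix (Fin 2) (Fin 2) ℂ)ᴴ := by
  rw [fundamentalRep_apply, fundamentalRep_apply, ← Matrix.star_eq_inv]
  rfl

omit [NeZero L] in
/-- ★ **The rectangle holonomy is the word of the translated rectangle shape**: for `V : SU(2)^E`,
`ρ(hol_(R×T)(x; i, j)) = Π letters` of the shape `[(m e_i, i, +)]_(m<R) ++ [(R e_i + m e_j, j, +)]_(m<T) ++ rev[(T e_j + m e_i, i, −)]_(m<R) ++ rev[(m e_j, j, −)]_(m<T)`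
translated by `x` (`+` ↦ `Q_e`, `−` ↦ `Q_eᴴ`). [folklore] -/
theorem fundamentalRep_rectangleHolonomy (V : (GaugeConfig 3 L (Matrix.specialUnitaryGroup (Fin 2) ℂ))) (x : Site 3 L) (i j : Fin 3) (R T : ℕ) :
    (fundamentalRep (Fin 2) (rectangleHolonomy V x i j R T) : Matrix (Fin 2) (Fin 2) ℂ) =
      (((((List.range R).map (fun m : ℕ => ((Pi.single i ((m : ℕ) : ZMod L) : Site 3 L), i, false)) ++ (List.range T).map (fun m : ℕ => ((Pi.single i ((R : ℕ) : ZMod L) : Site 3 L) + (Pi.single j ((m : ℕ) : ZMod L) : Site 3 L), j, false)) ++ ((List.range R).map (fun m : ℕ => ((Pi.single j ((T : ℕ) : ZMod L) : Site 3 L) + (Pi.single i ((m : ℕ) : ZMod L) : Site 3 L), i, true))).reverse ++ ((List.range T).map (fun m : ℕ => ((Pi.single j ((m : ℕ) : ZMod L) : Site 3 L), j, true))).reverse).map (fun q : Site 3 L × Fin 3 × Bool => ((x + q.1, q.2.1), q.2.2))).map (fun a : Edge 3 L × Bool => if a.2 then ((matrixConfig (fundamentalRep (Fin 2)) V) a.1)ᴴ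 else (matrixConfig (fundamentalRep (Fin 2)) V) a.1)).prod) := by
  classical
  set Q : MatrixConfig 3 L 2 := matrixConfig (fundamentalRep (Fin 2)) V with hQdef
  have hQe : ∀ e, Q e = (fundamentalRep (Fin 2) (V e) : Matrix (Fin 2) (Fin 2) ℂ) := fun e => rfl
  have hρprod : ∀ l : List (Matrix.specialUnitaryGroup (Fin 2) ℂ), (fundamentalRep (Fin 2) l.prod : Matrix (Fin 2) (Fin 2) ℂ) =
      (l.map fun g => (fundamentalRep (Fin 2) g : Matrix (Fin 2) (Fin 2) ℂ)).prod := fun l => map_list_prod (fundamentalRep (Fin 2)) l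
  -- the four legs as list products in the group
  have hL1 : lineHolonomy V i R x = ((List.range R).map fun m : ℕ => V (x + (Pi.single i ((m : ℕ) : ZMod L) : Site 3 L), i)).prod := lineHolonomy_eq_listProd V i R x
  have hL2 : lineHolonomy V j T (x + Pi.single i (R : ZMod L)) = ((List.range T).map fun m : ℕ => V (x + ((Pi.single i ((R : ℕ) : ZMod L) : Site 3 L) + (Pi.single j ((m : ℕ) : ZMod L) : Site 3 L)), j)).prod := by
    rw [lineHolonomy_eq_listProd V j T]
    refine congrArg List.prod (List.map_congr_left fun m _ => ?_)
    rw [add_assoc]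
  have hL3 : lineHolonomy V i R (x + Pi.single j (T : ZMod L)) = ((List.range R).map fun m : ℕ => V (x + ((Pi.single j ((T : ℕ) : ZMod L) : Site 3 L) + (Pi.single i ((m : ℕ) : ZMod L) : Site 3 L)), i)).prod := by
    rw [lineHolonomy_eq_listProd V i R]
    refine congrArg List.prod (List.map_congr_left fun m _ => ?_)
    rw [add_assoc]
  have hL4 : lineHolonomy V j T x = ((List.range T).map fun m : ℕ => V (x + (Pi.single j ((m : ℕ) : ZMod L) : Site 3 L), j)).prod := lineHolonomy_eq_listProd V j T x
  -- the word side: split the shape into its legs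
  rw [rectangleHolonomy, hL1, hL2, hL3, hL4, List.prod_inv_reverse, List.prod_inv_reverse, map_mul, map_mul, map_mul,
    hρprod, hρprod, hρprod, hρprod]
  simp only [List.map_append, List.map_reverse, List.map_map, List.prod_append, Function.comp_def, Bool.false_eq_true, if_false, if_true,
    fundamentalRep_inv_eq_conjTranspose, hQe]

omit [NeZero L] in
/-- The rectangle shape has `2(R+T)` letters. [folklore] -/
theorem rectShape_length (i j : Fin 3) (R T : ℕ) : (((List.range R).map (fun m : ℕ => ((Pi.single i ((m : ℕ) : ZMod L) : Site 3 L), i, false)) ++ (List.range T).map (fun m : ℕ => ((Pi.single i ((R : ℕ) : ZMod L) : Site 3 L) + (Pi.single j ((m : ℕ) : ZMod L) : Site 3 L), j, false)) ++ ((List.range R).map (fun m : ℕ => ((Pi.single j ((T : ℕ) : ZMod L) : Site 3 L) + (Pi.single i ((m : ℕ) : ZMod L) : Site 3 L), i, true))).reverse ++ ((List.range T).map (fun m : ℕ => ((Pi.single j ((m : ℕ) : ZMod L) : Site 3 L), j, true))).reverse)).length = 2 * (R + T) := by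
  simp only [List.length_append, List.length_map, List.length_range, List.length_reverse]
  ring

/-! ## §2. The averaged Wilson loop through the coordinates -/

/-- `0 < #sites = L³`. [folklore] -/
theorem card_site_three_pos (L : ℕ) [NeZero L] : 0 < (Fintype.card (Site 3 L) : ℝ) := by
  have : 0 < Fintype.card (Site 3 L) := Fintype.card_pos_iff.2 ⟨fun _ => 0⟩
  exact_mod_cast this

/-- `#E = 3·#sites`. [folklore] -/
theorem card_edge_eq_three_mul_card_site (L : ℕ) [NeZero L] : (Fintype.card (Edge 3 L) : ℝ) = 3 * (Fintype.card (Site 3 L) : ℝ) := by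
  rw [Fintype.card_prod, Fintype.card_fin]; push_cast; ring

/-- **The averaged loop functional is the spatially averaged Wilson loop**: with `c = 1/(2·#sites)`,
`(c·Σ_x Re tr w(ℓ+x))(coords V) = (#sites)⁻¹ Σ_x W_(R×T)(x; i, j)(V)`. [folklore] -/
theorem loopAverage_coords_eq (V : (GaugeConfig 3 L (Matrix.specialUnitaryGroup (Fin 2) ℂ))) (i j : Fin 3) (R T : ℕ) :
    (fun y : (Edge 3 L × Fin 2 × Fin 2 × Bool → ℝ) => (2 * (Fintype.card (Site 3 L) : ℝ))⁻¹ * ∑ x : Site 3 L, ((((((List.range R).map (fun m : ℕ => ((Pi.single i ((m : ℕ) : ZMod L) : Site 3 L), i, false)) ++ (List.range T).map (fun m : ℕ => ((Pi.single i ((R : ℕ) : ZMod L) : Site 3 L) + (Pi.single j ((m : ℕ) : ZMod L) : Site 3 L), j, false)) ++ ((List.range R).map (fun m : ℕ => ((Pi.single j ((T : ℕ) : ZMod L) : Site 3 L) + (Pi.single i ((m : ℕ) : ZMod L) : Site 3 L), i, true))).reverse ++ ((List.range T).map (fun m : ℕ => ((Pi.single j ((m : ℕ) : ZMod L) : Site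 3 L), j, true))).reverse).map (fun q : Site 3 L × Fin 3 × Bool => ((x + q.1, q.2.1), q.2.2))).map (fun a : Edge 3 L × Bool => if a.2 then ((fun (ee : Edge 3 L) => Matrix.of fun (i j : Fin 2) => ((y (ee, i, j, false) : ℝ) : ℂ) + ((y (ee, i, j, true) : ℝ) : ℂ) * Complex.I) a.1)ᴴ else (fun (ee : Edge 3 L) => Matrix.of fun (i j : Fin 2) => ((y (ee, i, j, false) : ℝ) : ℂ) + ((y (ee, i, j, true) : ℝ) : ℂ) * Complex.I) a.1)).prod)).trace.re) ((fun (V : GaugeConfig 3 L (Matrix.specialUnitaryGroup (Fin 2) ℂ)) (q : Edge 3 L × Fin 2 × Fin 2 × Bool) => (fun z : ℂ => if q.2.2.2 then z.im else z.re) ((fundamentalRep (Fin 2) (V q.1) : Matrix (Fin 2) (Fin 2) ℂ) q.2.1 q.2.2.1)) V) = (((Fintype.card (Site 3 L) : ℝ))⁻¹ * ∑ x : Site 3 L, wilsonLoop (fundamentalRep (Fin 2)) x i j R T V) := by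
  classical
  have hrebQ : (fun (ee : Edge 3 L) => Matrix.of fun (i j : Fin 2) => ((((fun (V : GaugeConfig 3 L (Matrix.specialUnitaryGroup (Fin 2) ℂ)) (q : Edge 3 L × Fin 2 × Fin 2 × Bool) => (fun z : ℂ => if q.2.2.2 then z.im else z.re) ((fundamentalRep (Fin 2) (V q.1) : Matrix (Fin 2) (Fin 2) ℂ) q.2.1 q.2.2.1)) V) (ee, i, j, false) : ℝ) : ℂ) + ((((fun (V : GaugeConfig 3 L (Matrix.specialUnitaryGroup (Fin 2) ℂ)) (q : Edge 3 L × Fin 2 × Fin 2 × Bool) => (fun z : ℂ => if q.2.2.2 then z.im else z.re) ((fundamentalRep (Fin 2) (V q.1) : Matrix (Fin 2) (Fin 2) ℂ) q.2.1 q.2.2.1)) V) (ee, i, j, true) : ℝ) : ℂ) * Complex.I) = matrixConfig (fundamentalRep (Fin 2)) V := by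
    funext e
    exact (congrFun (rebuild_coords_of V) e).trans (Matrix.ext fun a b => rfl)
  have hS : (0 : ℝ) < (Fintype.card (Site 3 L) : ℝ) := card_site_three_pos L
  show (2 * (Fintype.card (Site 3 L) : ℝ))⁻¹ * ∑ x : Site 3 L, ((((((List.range R).map (fun m : ℕ => ((Pi.single i ((m : ℕ) : ZMod L) : Site 3 L), i, false)) ++ (List.range T).map (fun m : ℕ => ((Pi.single i ((R : ℕ) : ZMod L) : Site 3 L) + (Pi.single j ((m : ℕ) : ZMod L) : Site 3 L), j, false)) ++ ((List.range R).map (fun m : ℕ => ((Pi.single j ((T : ℕ) : ZMod L) : Site 3 L) + (Pi.single i ((m : ℕ) : ZMod L) : Site 3 L), i, true))).reverse ++ ((List.range T).map (fun m : ℕ => ((Pi.single j ((m : ℕ) : ZMod L) : Site 3 L), j, true))).reverse).map (fun q : Site 3 L × Fin 3 × Bool => ((x + q.1, q.2.1), q.2.2))).map (fun a : Edge 3 L × Bool => if a.2 then ((fun (ee : Edge 3 L) => Matrix.of fun (i j : Fin 2) => ((((fun (V : GaugeConfig 3 L (Matrix.specialUnitaryGroup (Fin 2) ℂ)) (q : Edge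 3 L × Fin 2 × Fin 2 × Bool) => (fun z : ℂ => if q.2.2.2 then z.im else z.re) ((fundamentalRep (Fin 2) (V q.1) : Matrix (Fin 2) (Fin 2) ℂ) q.2.1 q.2.2.1)) V) (ee, i, j, false) : ℝ) : ℂ) + ((((fun (V : GaugeConfig 3 L (Matrix.specialUnitaryGroup (Fin 2) ℂ)) (q : Edge 3 L × Fin 2 × Fin 2 × Bool) => (fun z : ℂ => if q.2.2.2 then z.im else z.re) ((fundamentalRep (Fin 2) (V q.1) : Matrix (Fin 2) (Fin 2) ℂ) q.2.1 q.2.2.1)) V) (ee, i, j, true) : ℝ) : ℂ) * Complex.I) a.1)ᴴ else (fun (ee : Edge 3 L) => Matrix.of fun (i j : Fin 2) => ((((fun (V : GaugeConfig 3 L (Matrix.specialUnitaryGroup (Fin 2) ℂ)) (q : Edge 3 L × Fin 2 × Fin 2 × Bool) => (fun z : ℂ => if q.2.2.2 then z.im else z.re) ((fundamentalRep (Fin 2) (V q.1) : Matrix (Fin 2) (Fin 2) ℂ) q.2.1 q.2.2.1)) V) (ee, i, j, false) : ℝ) : ℂ) + ((((fun (V : GaugeConfig 3 L (Matrix.specialUnitaryGroup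 (Fin 2) ℂ)) (q : Edge 3 L × Fin 2 × Fin 2 × Bool) => (fun z : ℂ => if q.2.2.2 then z.im else z.re) ((fundamentalRep (Fin 2) (V q.1) : Matrix (Fin 2) (Fin 2) ℂ) q.2.1 q.2.2.1)) V) (ee, i, j, true) : ℝ) : ℂ) * Complex.I) a.1)).prod)).trace.re = (((Fintype.card (Site 3 L) : ℝ))⁻¹ * ∑ x : Site 3 L, wilsonLoop (fundamentalRep (Fin 2)) x i j R T V)
  rw [hrebQ, Finset.mul_sum, Finset.mul_sum]
  refine Finset.sum_congr rfl fun x _ => ?_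
  rw [wilsonLoop, fundamentalRep_rectangleHolonomy V x i j R T]
  push_cast
  field_simp

/-! ## §3. Variance and concentration of the averaged Wilson loop -/

/-- ★★ **Volume-uniform variance of the spatially averaged `R × T` Wilson loop** at `|β'| < 1/12`:
`Var_(μ_β')((L³)⁻¹ Σ_x W_(R×T)(x)) ≤ 48(R+T)²/((1 − 12|β'|)·L³)`. [cite: ShenZhuZhu2022, §4 Theorem 4.2, Corollary 4.4] -/
theorem wilson_loopAverage_variance_uniform (L : ℕ) [NeZero L] (β' : ℝ) (hβ : |β'| < 1 / 12) (i j : Fin 3) (R T : ℕ) :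
    ∫ V, ((((Fintype.card (Site 3 L) : ℝ))⁻¹ * ∑ x : Site 3 L, wilsonLoop (fundamentalRep (Fin 2)) x i j R T V) - ∫ V', (((Fintype.card (Site 3 L) : ℝ))⁻¹ * ∑ x : Site 3 L, wilsonLoop (fundamentalRep (Fin 2)) x i j R T V') ∂(wilsonMeasure (d := 3) (L := L) (fundamentalRep (Fin 2)) β')) ^ 2 ∂(wilsonMeasure (d := 3) (L := L) (fundamentalRep (Fin 2)) β')
      ≤ 48 * ((R : ℝ) + T) ^ 2 / ((1 - 12 * |β'|) * (Fintype.card (Site 3 L) : ℝ)) := by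
  classical
  haveI := secondCountableTopology_su2
  haveI := borelSpace_config L
  set μ : Measure (GaugeConfig 3 L (Matrix.specialUnitaryGroup (Fin 2) ℂ)) := (wilsonMeasure (d := 3) (L := L) (fundamentalRep (Fin 2)) β') with hμ
  haveI : IsProbabilityMeasure μ :=
    isProbabilityMeasure_wilsonMeasure (d := 3) (L := L) (fundamentalRep (Fin 2)) (continuous_fundamentalRep (Fin 2)) β'
  have hρ : 0 < 1 - 12 * |β'| := by linarith
  have hS : (0 : ℝ) < (Fintype.card (Site 3 L) : ℝ) := card_site_three_pos L
  set co : (GaugeConfig 3 L (Matrix.specialUnitaryGroup (Fin 2) ℂ)) → (Edge 3 L × Fin 2 × Fin 2 × Bool → ℝ) := (fun (V : GaugeConfig 3 L (Matrix.specialUnitaryGroup (Fin 2) ℂ)) (q : Edge 3 L × Fin 2 × Fin 2 × Bool) => (fun z : ℂ => if q.2.2.2 then z.im else z.re) ((fundamentalRep (Fin 2) (V q.1) : Matrix (Fin 2) (Fin 2) ℂ) q.2.1 q.2.2.1)) with hco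
  set fp : (Edge 3 L × Fin 2 × Fin 2 × Bool → ℝ) → ℝ := (fun y : (Edge 3 L × Fin 2 × Fin 2 × Bool → ℝ) => (2 * (Fintype.card (Site 3 L) : ℝ))⁻¹ * ∑ x : Site 3 L, ((((((List.range R).map (fun m : ℕ => ((Pi.single i ((m : ℕ) : ZMod L) : Site 3 L), i, false)) ++ (List.range T).map (fun m : ℕ => ((Pi.single i ((R : ℕ) : ZMod L) : Site 3 L) + (Pi.single j ((m : ℕ) : ZMod L) : Site 3 L), j, false)) ++ ((List.range R).map (fun m : ℕ => ((Pi.single j ((T : ℕ) : ZMod L) : Site 3 L) + (Pi.single i ((m : ℕ) : ZMod L) : Site 3 L), i, true))).reverse ++ ((List.range T).map (fun m : ℕ => ((Pi.single j ((m : ℕ) : ZMod L) : Site 3 L), j, true))).reverse).map (fun q : Site 3 L × Fin 3 × Bool => ((x + q.1, q.2.1), q.2.2))).map (fun a : Edge 3 L × Bool => if a.2 then ((fun (ee : Edge 3 L) => Matrix.of fun (i j : Fin 2) => ((y (ee, i, j, false) : ℝ) : ℂ) + ((y (ee, i, j, true) : ℝ) : ℂ) * Complex.I) a.1)ᴴ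 else (fun (ee : Edge 3 L) => Matrix.of fun (i j : Fin 2) => ((y (ee, i, j, false) : ℝ) : ℂ) + ((y (ee, i, j, true) : ℝ) : ℂ) * Complex.I) a.1)).prod)).trace.re) with hfp
  have hfpC : ContDiff ℝ 3 fp := contDiff_loopAverage _ _
  have hval : ∀ V : (GaugeConfig 3 L (Matrix.specialUnitaryGroup (Fin 2) ℂ)), fp (co V) = (((Fintype.card (Site 3 L) : ℝ))⁻¹ * ∑ x : Site 3 L, wilsonLoop (fundamentalRep (Fin 2)) x i j R T V) := fun V => loopAverage_coords_eq V i j R T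
  have hvar : ∫ V, (fp (co V) - ∫ V', fp (co V') ∂μ) ^ 2 ∂μ ≤
      (32 * ((2 * (Fintype.card (Site 3 L) : ℝ))⁻¹) ^ 2 * (((((List.range R).map (fun m : ℕ => ((Pi.single i ((m : ℕ) : ZMod L) : Site 3 L), i, false)) ++ (List.range T).map (fun m : ℕ => ((Pi.single i ((R : ℕ) : ZMod L) : Site 3 L) + (Pi.single j ((m : ℕ) : ZMod L) : Site 3 L), j, false)) ++ ((List.range R).map (fun m : ℕ => ((Pi.single j ((T : ℕ) : ZMod L) : Site 3 L) + (Pi.single i ((m : ℕ) : ZMod L) : Site 3 L), i, true))).reverse ++ ((List.range T).map (fun m : ℕ => ((Pi.single j ((m : ℕ) : ZMod L) : Site 3 L), j, true))).reverse)).length : ℕ) : ℝ) ^ 2 * Fintype.card (Edge 3 L)) / (2 * (1 - 12 * |β'|)) :=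
    wilson_variance_le_of_carre_uniform L β' fp hfpC _ hβ (wilson_loopAverage_carre_le L β' _ _)
  have hI : ∫ V, ((((Fintype.card (Site 3 L) : ℝ))⁻¹ * ∑ x : Site 3 L, wilsonLoop (fundamentalRep (Fin 2)) x i j R T V) - ∫ V', (((Fintype.card (Site 3 L) : ℝ))⁻¹ * ∑ x : Site 3 L, wilsonLoop (fundamentalRep (Fin 2)) x i j R T V') ∂μ) ^ 2 ∂μ = ∫ V, (fp (co V) - ∫ V', fp (co V') ∂μ) ^ 2 ∂μ := by
    refine integral_congr_ae (ae_of_all _ fun V => ?_)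
    beta_reduce
    rw [hval V]
    congr 2
    exact integral_congr_ae (ae_of_all _ fun V' => by beta_reduce; rw [hval V'])
  have hconst : (32 * ((2 * (Fintype.card (Site 3 L) : ℝ))⁻¹) ^ 2 * (((((List.range R).map (fun m : ℕ => ((Pi.single i ((m : ℕ) : ZMod L) : Site 3 L), i, false)) ++ (List.range T).map (fun m : ℕ => ((Pi.single i ((R : ℕ) : ZMod L) : Site 3 L) + (Pi.single j ((m : ℕ) : ZMod L) : Site 3 L), j, false)) ++ ((List.range R).map (fun m : ℕ => ((Pi.single j ((T : ℕ) : ZMod L) : Site 3 L) + (Pi.single i ((m : ℕ) : ZMod L) : Site 3 L), i, true))).reverse ++ ((List.range T).map (fun m : ℕ => ((Pi.single j ((m : ℕ) : ZMod L) : Site 3 L), j, true))).reverse)).length : ℕ) : ℝ) ^ 2 * Fintype.card (Edge 3 L)) / (2 * (1 - 12 * |β'|)) =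
      48 * ((R : ℝ) + T) ^ 2 / ((1 - 12 * |β'|) * (Fintype.card (Site 3 L) : ℝ)) := by
    rw [rectShape_length, card_edge_eq_three_mul_card_site]
    push_cast
    field_simp
    ring
  rw [hI, ← hconst]
  exact hvar

/-- ★★★ **Volume-uniform Gaussian concentration of the spatially averaged `R × T` Wilson loop** at `|β'| < 1/12`: for `R + T > 0`, `r ≥ 0`,
`μ_(β'){V | r ≤ |(L³)⁻¹Σ_x W_(R×T)(x)(V) − ∫ (L³)⁻¹Σ_x W_(R×T)(x) dμ_(β')|} ≤ 2·exp(−(1 − 12|β'|)·L³·r²/(96(R+T)²))` (`L³ = #sites`).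
[cite: ShenZhuZhu2022, §4 Theorem 4.2, Corollary 4.4] -/
theorem wilson_loopAverage_concentration_uniform (L : ℕ) [NeZero L] (β' : ℝ) (hβ : |β'| < 1 / 12) (i j : Fin 3) (R T : ℕ)
    (hRT : 0 < R + T) (r : ℝ) (hr : 0 ≤ r) :
    ((wilsonMeasure (d := 3) (L := L) (fundamentalRep (Fin 2)) β')).real {V | r ≤ |(((Fintype.card (Site 3 L) : ℝ))⁻¹ * ∑ x : Site 3 L, wilsonLoop (fundamentalRep (Fin 2)) x i j R T V) - ∫ V', (((Fintype.card (Site 3 L) : ℝ))⁻¹ * ∑ x : Site 3 L, wilsonLoop (fundamentalRep (Fin 2)) x i j R T V') ∂(wilsonMeasure (d := 3) (L := L) (fundamentalRep (Fin 2)) β')|} ≤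
      2 * Real.exp (-((1 - 12 * |β'|) * (Fintype.card (Site 3 L) : ℝ) * r ^ 2 / (96 * ((R : ℝ) + T) ^ 2))) := by
  classical
  haveI := secondCountableTopology_su2
  haveI := borelSpace_config L
  set μ : Measure (GaugeConfig 3 L (Matrix.specialUnitaryGroup (Fin 2) ℂ)) := (wilsonMeasure (d := 3) (L := L) (fundamentalRep (Fin 2)) β') with hμ
  haveI : IsProbabilityMeasure μ :=
    isProbabilityMeasure_wilsonMeasure (d := 3) (L := L) (fundamentalRep (Fin 2)) (continuous_fundamentalRep (Fin 2)) β'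
  have hS : (0 : ℝ) < (Fintype.card (Site 3 L) : ℝ) := card_site_three_pos L
  have hRT' : (0 : ℝ) < (R : ℝ) + T := by exact_mod_cast hRT
  set co : (GaugeConfig 3 L (Matrix.specialUnitaryGroup (Fin 2) ℂ)) → (Edge 3 L × Fin 2 × Fin 2 × Bool → ℝ) := (fun (V : GaugeConfig 3 L (Matrix.specialUnitaryGroup (Fin 2) ℂ)) (q : Edge 3 L × Fin 2 × Fin 2 × Bool) => (fun z : ℂ => if q.2.2.2 then z.im else z.re) ((fundamentalRep (Fin 2) (V q.1) : Matrix (Fin 2) (Fin 2) ℂ) q.2.1 q.2.2.1)) with hco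
  -- the carré constant for coefficient `b`
  have hlen : (((((List.range R).map (fun m : ℕ => ((Pi.single i ((m : ℕ) : ZMod L) : Site 3 L), i, false)) ++ (List.range T).map (fun m : ℕ => ((Pi.single i ((R : ℕ) : ZMod L) : Site 3 L) + (Pi.single j ((m : ℕ) : ZMod L) : Site 3 L), j, false)) ++ ((List.range R).map (fun m : ℕ => ((Pi.single j ((T : ℕ) : ZMod L) : Site 3 L) + (Pi.single i ((m : ℕ) : ZMod L) : Site 3 L), i, true))).reverse ++ ((List.range T).map (fun m : ℕ => ((Pi.single j ((m : ℕ) : ZMod L) : Site 3 L), j, true))).reverse)).length : ℕ) : ℝ) = 2 * ((R : ℝ) + T) := by rw [rectShape_length]; push_cast; ring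
  have key : ∀ b : ℝ, b ≠ 0 →
      μ.real {V | (∫ V', (fun y : (Edge 3 L × Fin 2 × Fin 2 × Bool → ℝ) => b * ∑ x : Site 3 L, ((((((List.range R).map (fun m : ℕ => ((Pi.single i ((m : ℕ) : ZMod L) : Site 3 L), i, false)) ++ (List.range T).map (fun m : ℕ => ((Pi.single i ((R : ℕ) : ZMod L) : Site 3 L) + (Pi.single j ((m : ℕ) : ZMod L) : Site 3 L), j, false)) ++ ((List.range R).map (fun m : ℕ => ((Pi.single j ((T : ℕ) : ZMod L) : Site 3 L) + (Pi.single i ((m : ℕ) : ZMod L) : Site 3 L), i, true))).reverse ++ ((List.range T).map (fun m : ℕ => ((Pi.single j ((m : ℕ) : ZMod L) : Site 3 L), j, true))).reverse).map (fun q : Site 3 L × Fin 3 × Bool => ((x + q.1, q.2.1), q.2.2))).map (fun a : Edge 3 L × Bool => if a.2 then ((fun (ee : Edge 3 L) => Matrix.of fun (i j : Fin 2) => ((y (ee, i, j, false) : ℝ) : ℂ) + ((y (ee, i, j, true) : ℝ) : ℂ) * Complex.I) a.1)ᴴ else (fun (ee : Edge 3 L) => Matrix.of fun (i j : Fin 2)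 => ((y (ee, i, j, false) : ℝ) : ℂ) + ((y (ee, i, j, true) : ℝ) : ℂ) * Complex.I) a.1)).prod)).trace.re) (co V') ∂μ) + r ≤ (fun y : (Edge 3 L × Fin 2 × Fin 2 × Bool → ℝ) => b * ∑ x : Site 3 L, ((((((List.range R).map (fun m : ℕ => ((Pi.single i ((m : ℕ) : ZMod L) : Site 3 L), i, false)) ++ (List.range T).map (fun m : ℕ => ((Pi.single i ((R : ℕ) : ZMod L) : Site 3 L) + (Pi.single j ((m : ℕ) : ZMod L) : Site 3 L), j, false)) ++ ((List.range R).map (fun m : ℕ => ((Pi.single j ((T : ℕ) : ZMod L) : Site 3 L) + (Pi.single i ((m : ℕ) : ZMod L) : Site 3 L), i, true))).reverse ++ ((List.range T).map (fun m : ℕ => ((Pi.single j ((m : ℕ) : ZMod L) : Site 3 L), j, true))).reverse).map (fun q : Site 3 L × Fin 3 × Bool => ((x + q.1, q.2.1), q.2.2))).map (fun a : Edge 3 L × Bool => if a.2 then ((fun (ee : Edge 3 L) => Matrix.of fun (i j : Fin 2) => ((y (ee, i, j, false) : ℝ) : ℂ) + ((y (ee, i, j, true) : ℝ) : ℂ)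 * Complex.I) a.1)ᴴ else (fun (ee : Edge 3 L) => Matrix.of fun (i j : Fin 2) => ((y (ee, i, j, false) : ℝ) : ℂ) + ((y (ee, i, j, true) : ℝ) : ℂ) * Complex.I) a.1)).prod)).trace.re) (co V)} ≤
        Real.exp (-((1 - 12 * |β'|) * r ^ 2 / (32 * b ^ 2 * (((((List.range R).map (fun m : ℕ => ((Pi.single i ((m : ℕ) : ZMod L) : Site 3 L), i, false)) ++ (List.range T).map (fun m : ℕ => ((Pi.single i ((R : ℕ) : ZMod L) : Site 3 L) + (Pi.single j ((m : ℕ) : ZMod L) : Site 3 L), j, false)) ++ ((List.range R).map (fun m : ℕ => ((Pi.single j ((T : ℕ) : ZMod L) : Site 3 L) + (Pi.single i ((m : ℕ) : ZMod L) : Site 3 L), i, true))).reverse ++ ((List.range T).map (fun m : ℕ => ((Pi.single j ((m : ℕ) : ZMod L) : Site 3 L), j, true))).reverse)).length : ℕ) : ℝ) ^ 2 * Fintype.card (Edge 3 L)))) := by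
    intro b hb
    have hs : 0 < 32 * b ^ 2 * (((((List.range R).map (fun m : ℕ => ((Pi.single i ((m : ℕ) : ZMod L) : Site 3 L), i, false)) ++ (List.range T).map (fun m : ℕ => ((Pi.single i ((R : ℕ) : ZMod L) : Site 3 L) + (Pi.single j ((m : ℕ) : ZMod L) : Site 3 L), j, false)) ++ ((List.range R).map (fun m : ℕ => ((Pi.single j ((T : ℕ) : ZMod L) : Site 3 L) + (Pi.single i ((m : ℕ) : ZMod L) : Site 3 L), i, true))).reverse ++ ((List.range T).map (fun m : ℕ => ((Pi.single j ((m : ℕ) : ZMod L) : Site 3 L), j, true))).reverse)).length : ℕ) : ℝ) ^ 2 * Fintype.card (Edge 3 L) := by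
      have : 0 < b ^ 2 := by positivity
      rw [hlen, card_edge_eq_three_mul_card_site]
      positivity
    exact wilson_concentration_uniform L β' hβ (fun y : (Edge 3 L × Fin 2 × Fin 2 × Bool → ℝ) => b * ∑ x : Site 3 L, ((((((List.range R).map (fun m : ℕ => ((Pi.single i ((m : ℕ) : ZMod L) : Site 3 L), i, false)) ++ (List.range T).map (fun m : ℕ => ((Pi.single i ((R : ℕ) : ZMod L) : Site 3 L) + (Pi.single j ((m : ℕ) : ZMod L) : Site 3 L), j, false)) ++ ((List.range R).map (fun m : ℕ => ((Pi.single j ((T : ℕ) : ZMod L) : Site 3 L) + (Pi.single i ((m : ℕ) : ZMod L) : Site 3 L), i, true))).reverse ++ ((List.range T).map (fun m : ℕ => ((Pi.single j ((m : ℕ) : ZMod L) : Site 3 L), j, true))).reverse).map (fun q : Site 3 L × Fin 3 × Bool => ((x + q.1, q.2.1), q.2.2))).map (fun a : Edge 3 L × Bool => if a.2 then ((fun (ee : Edge 3 L) => Matrix.of fun (i j : Fin 2) => ((y (ee, i, j, false) : ℝ) : ℂ) + ((y (ee, i, j, true) : ℝ) : ℂ) * Complex.I) a.1)ᴴ else (fun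 (ee : Edge 3 L) => Matrix.of fun (i j : Fin 2) => ((y (ee, i, j, false) : ℝ) : ℂ) + ((y (ee, i, j, true) : ℝ) : ℂ) * Complex.I) a.1)).prod)).trace.re) (contDiff_loopAverage _ b) hs (wilson_loopAverage_carre_le L β' _ b) r hr
  have hp := key (2 * (Fintype.card (Site 3 L) : ℝ))⁻¹ (inv_ne_zero (by positivity))
  have hm := key (-(2 * (Fintype.card (Site 3 L) : ℝ))⁻¹) (neg_ne_zero.2 (inv_ne_zero (by positivity)))
  set fp : (Edge 3 L × Fin 2 × Fin 2 × Bool → ℝ) → ℝ := (fun y : (Edge 3 L × Fin 2 × Fin 2 × Bool → ℝ) => (2 * (Fintype.card (Site 3 L) : ℝ))⁻¹ * ∑ x : Site 3 L, ((((((List.range R).map (fun m : ℕ => ((Pi.single i ((m : ℕ) : ZMod L) : Site 3 L), i, false)) ++ (List.range T).map (fun m : ℕ => ((Pi.single i ((R : ℕ) : ZMod L) : Site 3 L) + (Pi.single j ((m : ℕ) : ZMod L) : Site 3 L), j, false)) ++ ((List.range R).map (fun m : ℕ => ((Pi.single j ((T : ℕ) : ZMod L) : Site 3 L) + (Pi.single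 i ((m : ℕ) : ZMod L) : Site 3 L), i, true))).reverse ++ ((List.range T).map (fun m : ℕ => ((Pi.single j ((m : ℕ) : ZMod L) : Site 3 L), j, true))).reverse).map (fun q : Site 3 L × Fin 3 × Bool => ((x + q.1, q.2.1), q.2.2))).map (fun a : Edge 3 L × Bool => if a.2 then ((fun (ee : Edge 3 L) => Matrix.of fun (i j : Fin 2) => ((y (ee, i, j, false) : ℝ) : ℂ) + ((y (ee, i, j, true) : ℝ) : ℂ) * Complex.I) a.1)ᴴ else (fun (ee : Edge 3 L) => Matrix.of fun (i j : Fin 2) => ((y (ee, i, j, false) : ℝ) : ℂ) + ((y (ee, i, j, true) : ℝ) : ℂ) * Complex.I) a.1)).prod)).trace.re) with hfpdef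
  set fm : (Edge 3 L × Fin 2 × Fin 2 × Bool → ℝ) → ℝ := (fun y : (Edge 3 L × Fin 2 × Fin 2 × Bool → ℝ) => (-(2 * (Fintype.card (Site 3 L) : ℝ))⁻¹) * ∑ x : Site 3 L, ((((((List.range R).map (fun m : ℕ => ((Pi.single i ((m : ℕ) : ZMod L) : Site 3 L), i, false)) ++ (List.range T).map (fun m : ℕ => ((Pi.single i ((R : ℕ) : ZMod L) : Site 3 L) + (Pi.single j ((m : ℕ) : ZMod L) : Site 3 L), j, false)) ++ ((List.range R).map (fun m : ℕ => ((Pi.single j ((T : ℕ) : ZMod L) : Site 3 L) + (Pi.single i ((m : ℕ) : ZMod L) : Site 3 L), i, true))).reverse ++ ((List.range T).map (fun m : ℕ => ((Pi.single j ((m : ℕ) : ZMod L) : Site 3 L), j, true))).reverse).map (fun q : Site 3 L × Fin 3 × Bool => ((x + q.1, q.2.1), q.2.2))).map (fun a : Edge 3 L × Bool => if a.2 then ((fun (ee : Edge 3 L) => Matrix.of fun (i j : Fin 2) => ((y (ee, i, j, false) : ℝ) : ℂ) + ((y (ee, i, j, true) : ℝ) : ℂ) * Complex.I) a.1)ᴴ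 else (fun (ee : Edge 3 L) => Matrix.of fun (i j : Fin 2) => ((y (ee, i, j, false) : ℝ) : ℂ) + ((y (ee, i, j, true) : ℝ) : ℂ) * Complex.I) a.1)).prod)).trace.re) with hfmdef
  have hvalp : ∀ V : (GaugeConfig 3 L (Matrix.specialUnitaryGroup (Fin 2) ℂ)), fp (co V) = (((Fintype.card (Site 3 L) : ℝ))⁻¹ * ∑ x : Site 3 L, wilsonLoop (fundamentalRep (Fin 2)) x i j R T V) := fun V => loopAverage_coords_eq V i j R T
  have hfm_neg : ∀ z : (Edge 3 L × Fin 2 × Fin 2 × Bool → ℝ), fm z = -fp z := fun z => by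
    simp only [hfpdef, hfmdef]
    ring
  have hvalm : ∀ V : (GaugeConfig 3 L (Matrix.specialUnitaryGroup (Fin 2) ℂ)), fm (co V) = -(((Fintype.card (Site 3 L) : ℝ))⁻¹ * ∑ x : Site 3 L, wilsonLoop (fundamentalRep (Fin 2)) x i j R T V) := fun V => by rw [hfm_neg, hvalp]
  have hmeanp : ∫ V', fp (co V') ∂μ = ∫ V', (((Fintype.card (Site 3 L) : ℝ))⁻¹ * ∑ x : Site 3 L, wilsonLoop (fundamentalRep (Fin 2)) x i j R T V') ∂μ :=
    integral_congr_ae (ae_of_all _ fun V' => by beta_reduce; rw [hvalp V'])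
  have hmeanm : ∫ V', fm (co V') ∂μ = -∫ V', (((Fintype.card (Site 3 L) : ℝ))⁻¹ * ∑ x : Site 3 L, wilsonLoop (fundamentalRep (Fin 2)) x i j R T V') ∂μ := by
    rw [← integral_neg]
    exact integral_congr_ae (ae_of_all _ fun V' => by beta_reduce; rw [hvalm V'])
  have hsub : {V : (GaugeConfig 3 L (Matrix.specialUnitaryGroup (Fin 2) ℂ)) | r ≤ |(((Fintype.card (Site 3 L) : ℝ))⁻¹ * ∑ x : Site 3 L, wilsonLoop (fundamentalRep (Fin 2)) x i j R T V) - ∫ V', (((Fintype.card (Site 3 L) : ℝ))⁻¹ * ∑ x : Site 3 L, wilsonLoop (fundamentalRep (Fin 2)) x i j R T V') ∂μ|} ⊆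
      {V | (∫ V', fp (co V') ∂μ) + r ≤ fp (co V)} ∪ {V | (∫ V', fm (co V') ∂μ) + r ≤ fm (co V)} := by
    intro V hV
    simp only [Set.mem_setOf_eq, Set.mem_union] at hV ⊢
    rw [hmeanp, hvalp, hmeanm, hvalm]
    rcases le_abs.1 hV with h | h
    · left; linarith
    · right; linarith
  have e1 : ∀ b : ℝ, b ^ 2 = ((2 * (Fintype.card (Site 3 L) : ℝ))⁻¹) ^ 2 →
      Real.exp (-((1 - 12 * |β'|) * r ^ 2 / (32 * b ^ 2 * (((((List.range R).map (fun m : ℕ => ((Pi.single i ((m : ℕ) : ZMod L) : Site 3 L), i, false)) ++ (List.range T).map (fun m : ℕ => ((Pi.single i ((R : ℕ) : ZMod L) : Site 3 L) + (Pi.single j ((m : ℕ) : ZMod L) : Site 3 L), j, false)) ++ ((List.range R).map (fun m : ℕ => ((Pi.single j ((T : ℕ) : ZMod L) : Site 3 L) + (Pi.single i ((m : ℕ) : ZMod L) : Site 3 L), i, true))).reverse ++ ((List.range T).map (fun m : ℕ => ((Pi.single j ((m : ℕ) : ZMod L) : Site 3 L), j, true))).reverse)).length : ℕ) : ℝ)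 ^ 2 * Fintype.card (Edge 3 L)))) =
      Real.exp (-((1 - 12 * |β'|) * (Fintype.card (Site 3 L) : ℝ) * r ^ 2 / (96 * ((R : ℝ) + T) ^ 2))) := by
    intro b hb
    congr 1
    rw [hb, hlen, card_edge_eq_three_mul_card_site]
    field_simp
    ring
  rw [e1 _ rfl] at hp
  rw [e1 _ (by ring)] at hm
  calc μ.real {V : (GaugeConfig 3 L (Matrix.specialUnitaryGroup (Fin 2) ℂ)) | r ≤ |(((Fintype.card (Site 3 L) : ℝ))⁻¹ * ∑ x : Site 3 L, wilsonLoop (fundamentalRep (Fin 2)) x i j R T V) - ∫ V', (((Fintype.card (Site 3 L) : ℝ))⁻¹ * ∑ x : Site 3 L, wilsonLoop (fundamentalRep (Fin 2)) x i j R T V') ∂μ|}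
      ≤ μ.real ({V | (∫ V', fp (co V') ∂μ) + r ≤ fp (co V)} ∪ {V | (∫ V', fm (co V') ∂μ) + r ≤ fm (co V)}) := measureReal_mono hsub
    _ ≤ μ.real {V | (∫ V', fp (co V') ∂μ) + r ≤ fp (co V)} + μ.real {V | (∫ V', fm (co V') ∂μ) + r ≤ fm (co V)} :=
        measureReal_union_le _ _
    _ ≤ Real.exp (-((1 - 12 * |β'|) * (Fintype.card (Site 3 L) : ℝ) * r ^ 2 / (96 * ((R : ℝ) + T) ^ 2))) +
          Real.exp (-((1 - 12 * |β'|) * (Fintype.card (Site 3 L) : ℝ) * r ^ 2 / (96 * ((R : ℝ) + T) ^ 2))) := add_le_add hp hm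
    _ = 2 * Real.exp (-((1 - 12 * |β'|) * (Fintype.card (Site 3 L) : ℝ) * r ^ 2 / (96 * ((R : ℝ) + T) ^ 2))) := by ring

end Summit.QuantumFields.YangMills.Theorems.ColdStartUniversality
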